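import Mathlib.MeasureTheory.Measure.Prokhorov
import Mathlib.MeasureTheory.Measure.LevyProkhorovMetric
import Mathlib.Analysis.SpecificLimits.Basic
import Literature.MathematicalPhysics.QuantumLattice.LatticeGaugeDLR
import HarnessLib

/-!
# Extraction of a tangent law: Prokhorov subsequence for laws on `2`-cochains

Crux `stmt-QuantumFields-8760` (`EquipartitionPinsProbe`), line `Sketch`, stub `stub_extraction` (TX)
of the reshaped `stub_tangentCore`.

A sequence `ν_k` of probability measures on the `ℝ^D`-valued `2`-cochains
`Ω := ZdPlaquette 4 → Fin D → ℝ` of `ℤ⁴` (product topology and product σ-algebra; a countable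
product of real lines, hence Polish) whose coordinates have bounded second moments,
`∫ (Y p a)² dν_k ≤ C_{p,a}` for all `k`, has a weakly convergent subsequence:

* tightness (`TangentExtraction.isTightMeasureSet_of_sq_moments`): with summable weights
  `δ_{p,a} > 0`, `∑ δ < ε` on the countable index set (`ENNReal.exists_pos_sum_of_countable`) and
  radii `M_{p,a} := √((|C_{p,a}| + 1) / δ_{p,a})`, the box `K := ∏ [-M_{p,a}, M_{p,a}]` is compact
  (Tychonoff) and Chebyshev (`TangentExtraction.measure_lt_abs_le`) gives
  `ν_k Kᶜ ≤ ∑ ν_k {M_{p,a} < |Y p a|} ≤ ∑ δ_{p,a} ≤ ε`;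
* Prokhorov (`isCompact_closure_of_isTightMeasureSet`): the closure of `{ν_k}` in
  `ProbabilityMeasure Ω` is compact, and `ProbabilityMeasure Ω` is (pseudo)metrisable for the
  separable metrisable `Ω` (Lévy–Prokhorov), so a subsequence converges;
* convergence in `ProbabilityMeasure Ω` is convergence of the integrals of bounded continuous
  functions (`ProbabilityMeasure.tendsto_iff_forall_integral_tendsto`).

Pure measure theory on Mathlib; no lattice gauge theory is used beyond the (countable) index type
`ZdPlaquette 4`.
-/

noncomputable section

open MeasureTheory Filter Topology
open scoped ENNReal NNReal
open Literature.MathematicalPhysics.QuantumLattice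

namespace Summit.QuantumFields.YangMills.Theorems.EquipartitionPinsProbe

namespace TangentExtraction

/-- Chebyshev for second moments, in the form used for tightness: if `∫ g² dμ ≤ C` then
`μ {M < |g|} ≤ δ` for the radius `M := √((|C| + 1) / δ)`, `δ > 0`. -/
theorem measure_lt_abs_le {Ω : Type*} [MeasurableSpace Ω] {μ : Measure Ω} [IsFiniteMeasure μ]
    {g : Ω → ℝ} {C : ℝ} (hint : Integrable (fun x => g x ^ 2) μ) (hC : ∫ x, g x ^ 2 ∂μ ≤ C)
    {δ : ℝ≥0} (hδ : 0 < δ) :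
    μ {x | Real.sqrt ((|C| + 1) / δ) < |g x|} ≤ (δ : ℝ≥0∞) := by
  set M := Real.sqrt ((|C| + 1) / δ) with hM
  have hC1 : 0 < |C| + 1 := by positivity
  have hR : 0 < (|C| + 1) / (δ : ℝ) := div_pos hC1 (NNReal.coe_pos.2 hδ)
  have hM2 : M ^ 2 = (|C| + 1) / δ := Real.sq_sqrt hR.le
  have hMpos : 0 < M := Real.sqrt_pos.2 hR
  have h1 : {x | M < |g x|} ⊆ {x | M ^ 2 ≤ g x ^ 2} := fun x (hx : M < |g x|) => by
    have hx' : |M| ≤ |g x| := by rw [abs_of_pos hMpos]; exact hx.le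
    exact sq_le_sq.2 hx'
  have h2 : M ^ 2 * μ.real {x | M ^ 2 ≤ g x ^ 2} ≤ ∫ x, g x ^ 2 ∂μ :=
    mul_meas_ge_le_integral_of_nonneg (ae_of_all _ fun x => sq_nonneg (g x)) hint (M ^ 2)
  have h3 : μ.real {x | M < |g x|} ≤ δ :=
    calc μ.real {x | M < |g x|} ≤ μ.real {x | M ^ 2 ≤ g x ^ 2} := measureReal_mono h1
      _ ≤ |C| / M ^ 2 := by
          rw [le_div_iff₀ (pow_pos hMpos 2), mul_comm]
          exact h2.trans (hC.trans (le_abs_self C))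
      _ ≤ δ := by
          rw [hM2, div_div_eq_mul_div, div_le_iff₀ hC1]
          nlinarith [abs_nonneg C, NNReal.coe_pos.2 hδ]
  calc μ {x | M < |g x|} = ENNReal.ofReal (μ.real {x | M < |g x|}) := (ofReal_measureReal (measure_ne_top μ _)).symm
    _ ≤ ENNReal.ofReal (δ : ℝ) := ENNReal.ofReal_le_ofReal h3
    _ = δ := ENNReal.ofReal_coe_nnreal

/-- **Tightness from second moments** on a countable product of real lines `α → β → ℝ`
(`α`, `β` countable, product topology): a family `S` of finite measures with
`∫ (Y a b)² dμ ≤ C a b` for all `μ ∈ S` and all coordinates `(a, b)` is tight — the compact set is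
the box `∏_{a,b} [-M a b, M a b]` with `M a b = √((|C a b| + 1) / δ_{(a,b)})` for summable positive
weights `δ`, by Chebyshev and a union bound. -/
theorem isTightMeasureSet_of_sq_moments {α β : Type*} [Countable α] [Countable β]
    {S : Set (Measure (α → β → ℝ))} (C : α → β → ℝ)
    (hC : ∀ μ ∈ S, ∀ (a : α) (b : β),
      Integrable (fun Y => (Y a b) ^ 2) μ ∧ ∫ Y, (Y a b) ^ 2 ∂μ ≤ C a b)
    (hfin : ∀ μ ∈ S, IsFiniteMeasure μ) :
    IsTightMeasureSet S := by
  rw [isTightMeasureSet_iff_exists_isCompact_measure_compl_le]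
  intro ε hε
  obtain ⟨δ, hδpos, hδsum⟩ := ENNReal.exists_pos_sum_of_countable hε.ne' (α × β)
  set M : α → β → ℝ := fun a b => Real.sqrt ((|C a b| + 1) / δ (a, b)) with hM
  refine ⟨Set.pi Set.univ fun a => Set.pi Set.univ fun b => Set.Icc (-M a b) (M a b),
    isCompact_univ_pi fun a => isCompact_univ_pi fun b => isCompact_Icc, fun μ hμ => ?_⟩
  haveI := hfin μ hμ
  have hsub : (Set.pi Set.univ fun a => Set.pi Set.univ fun b => Set.Icc (-M a b) (M a b))ᶜ ⊆
      ⋃ i : α × β, {Y : α → β → ℝ | M i.1 i.2 < |Y i.1 i.2|} := by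
    intro Y hY
    simp only [Set.mem_compl_iff, Set.mem_univ_pi, Set.mem_Icc, ← abs_le, not_forall, not_le] at hY
    obtain ⟨a, b, hab⟩ := hY
    exact Set.mem_iUnion.2 ⟨(a, b), hab⟩
  calc μ _ ≤ μ (⋃ i : α × β, {Y : α → β → ℝ | M i.1 i.2 < |Y i.1 i.2|}) := measure_mono hsub
    _ ≤ ∑' i : α × β, μ {Y : α → β → ℝ | M i.1 i.2 < |Y i.1 i.2|} := measure_iUnion_le _
    _ ≤ ∑' i : α × β, (δ i : ℝ≥0∞) := ENNReal.tsum_le_tsum fun i =>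
        measure_lt_abs_le (hC μ hμ i.1 i.2).1 (hC μ hμ i.1 i.2).2 (hδpos i)
    _ ≤ ε := hδsum.le

end TangentExtraction

/-- STUB TX — **extraction of a tangent law** (Chebyshev ⇒ tightness on the countable product,
Prokhorov `isCompact_closure_of_isTightMeasureSet`, metrisability of `ProbabilityMeasure`): a sequence of
probability measures on `ℝ^D`-valued `2`-cochains with coordinatewise bounded second moments has a weakly
convergent subsequence. -/
theorem stub_extraction :
    ∀ (D : ℕ) (ν : ℕ → MeasureTheory.Measure (Literature.MathematicalPhysics.QuantumLattice.ZdPlaquette 4 → Fin D → ℝ)),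
      (∀ k, MeasureTheory.IsProbabilityMeasure (ν k)) →
      (∀ (p : Literature.MathematicalPhysics.QuantumLattice.ZdPlaquette 4) (a : Fin D), ∃ C : ℝ, ∀ k : ℕ,
        MeasureTheory.Integrable (fun Y => (Y p a) ^ 2) (ν k) ∧ ∫ Y, (Y p a) ^ 2 ∂(ν k) ≤ C) →
      ∃ (φ : ℕ → ℕ) (τ : MeasureTheory.Measure (Literature.MathematicalPhysics.QuantumLattice.ZdPlaquette 4 → Fin D → ℝ)),
        StrictMono φ ∧ MeasureTheory.IsProbabilityMeasure τ ∧
        ∀ f : (Literature.MathematicalPhysics.QuantumLattice.ZdPlaquette 4 → Fin D → ℝ) → ℝ, Continuous f → (∃ C : ℝ, ∀ Y, |f Y| ≤ C) →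
          Filter.Tendsto (fun j : ℕ => ∫ Y, f Y ∂(ν (φ j))) Filter.atTop (nhds (∫ Y, f Y ∂τ)) := by
  intro D ν hν hmom
  choose C hC using hmom
  -- the laws as a sequence in `ProbabilityMeasure Ω`
  let P : ℕ → ProbabilityMeasure (ZdPlaquette 4 → Fin D → ℝ) := fun k => ⟨ν k, hν k⟩
  have htight : IsTightMeasureSet
      {x | ∃ μ ∈ Set.range P, (μ : Measure (ZdPlaquette 4 → Fin D → ℝ)) = x} := by
    refine TangentExtraction.isTightMeasureSet_of_sq_moments C ?_ ?_
    · rintro _ ⟨_, ⟨k, rfl⟩, rfl⟩ p a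
      exact hC p a k
    · rintro _ ⟨μ, _, rfl⟩
      infer_instance
  obtain ⟨P', -, φ, hφ, hlim⟩ := (isCompact_closure_of_isTightMeasureSet htight).tendsto_subseq
    (x := P) fun n => subset_closure (Set.mem_range_self n)
  refine ⟨φ, P', hφ, inferInstance, fun f hf hb => ?_⟩
  obtain ⟨B, hB⟩ := hb
  have h := (ProbabilityMeasure.tendsto_iff_forall_integral_tendsto.1 hlim)
    (BoundedContinuousFunction.ofNormedAddCommGroup f hf B fun Y => (Real.norm_eq_abs _).trans_le (hB Y))
  simpa [P] using h

end Summit.QuantumFields.YangMills.Theorems.EquipartitionPinsProbe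

end
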